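import Mathlib.Analysis.SpecialFunctions.Pow.Real
import Mathlib.Tactic.Ring
import Mathlib.Tactic.Linarith
import Mathlib.Tactic.Positivity

/-!
# Robustness of a block decay rate (card B, second lemma)

Helper file for the crux `QuadrupoleSelectionRule` (stmt-CriticalPhenomena-7029, informal) of route
`CardyFlipRusso` (sub-problem `CardyFormulaZ2`), line `Sketch`: the card statement
`RobustBlockDecay` of idea card `leg-continuity-robust-gap` (proved by the planner in the Sketch;
recorded here as a landed theorem so that the line's composition imports it).

A quasi-submultiplicative two-scale quantity `a m n ≤ C · a m k · a k n` (think: the operator norm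
of the annulus four-arm transfer from dyadic scale `m` to scale `n` restricted to a symmetry
sector, normalised by the four-arm probability) whose one-block values are `≤ q` decays
geometrically with ratio `C q` along blocks of length `L`.  With `q = q_{CLE₆}(L) + (perturbation)`
this is how a continuum spectral gap survives an `O(1)`-small perturbation of the kernels.
-/

namespace Summit.CriticalPhenomena.CardyFormulaZ2.Theorems

/-- **Card B, second lemma (`RobustBlockDecay`): chaining a quasi-submultiplicative bound.** If
`0 ≤ a`, `a m n ≤ C · a m k · a k n` for `m ≤ k ≤ n` (`C ≥ 0`) and every block of length `L` has
`a k (k + L) ≤ q`, then `a 0 (n L) ≤ a 0 0 · (C q)ⁿ`. [folklore] -/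
theorem robust_block_decay (C q : ℝ) (L : ℕ) (a : ℕ → ℕ → ℝ) (hC : 0 ≤ C)
    (ha : ∀ m n, 0 ≤ a m n) (hsub : ∀ m k n, m ≤ k → k ≤ n → a m n ≤ C * a m k * a k n)
    (hq : ∀ k, a k (k + L) ≤ q) (n : ℕ) : a 0 (n * L) ≤ a 0 0 * (C * q) ^ n := by
  induction n with
  | zero => simp
  | succ n ih =>
    have h1 : a 0 ((n + 1) * L) ≤ C * a 0 (n * L) * a (n * L) ((n + 1) * L) :=
      hsub 0 (n * L) ((n + 1) * L) (Nat.zero_le _) (by nlinarith)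
    have h2 : a (n * L) ((n + 1) * L) ≤ q := by
      have := hq (n * L)
      simpa [Nat.succ_mul, Nat.add_comm] using this
    have hq0 : 0 ≤ q := le_trans (ha _ _) (hq 0)
    calc a 0 ((n + 1) * L) ≤ C * a 0 (n * L) * a (n * L) ((n + 1) * L) := h1
      _ ≤ C * a 0 (n * L) * q := by
          apply mul_le_mul_of_nonneg_left h2
          exact mul_nonneg hC (ha _ _)
      _ ≤ C * (a 0 0 * (C * q) ^ n) * q := by
          apply mul_le_mul_of_nonneg_right _ hq0
          exact mul_le_mul_of_nonneg_left ih hC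
      _ = a 0 0 * (C * q) ^ (n + 1) := by ring

/-- The decay is genuinely geometric as soon as `C q < 1`: `a 0 (n L) ≤ a 0 0 · ρⁿ` with
`ρ = C q ∈ [0, 1)` — the form in which the robust gap is consumed (any `q < 1/C` will do, an OPEN
condition on the one-block values). [folklore] -/
theorem robust_block_decay_tendsto_zero (C q : ℝ) (L : ℕ) (a : ℕ → ℕ → ℝ) (hC : 0 ≤ C)
    (ha : ∀ m n, 0 ≤ a m n) (hsub : ∀ m k n, m ≤ k → k ≤ n → a m n ≤ C * a m k * a k n)
    (hq : ∀ k, a k (k + L) ≤ q) (hCq : C * q < 1) :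
    Filter.Tendsto (fun n : ℕ => a 0 (n * L)) Filter.atTop (nhds 0) := by
  have hq0 : 0 ≤ q := le_trans (ha _ _) (by simpa using hq 0)
  have hρ0 : 0 ≤ C * q := mul_nonneg hC hq0
  have hgeom : Filter.Tendsto (fun n : ℕ => a 0 0 * (C * q) ^ n) Filter.atTop (nhds 0) := by
    simpa using (tendsto_pow_atTop_nhds_zero_of_lt_one hρ0 hCq).const_mul (a 0 0)
  refine squeeze_zero (fun n => ha _ _) (fun n => ?_) hgeom
  exact robust_block_decay C q L a hC ha hsub hq n

end Summit.CriticalPhenomena.CardyFormulaZ2.Theorems
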